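import Mathlib.Analysis.Calculus.Deriv.MeanValue
import Literature.Geometry.Riemannian.ShrinkingSphereMonotonicity
import Literature.Geometry.Riemannian.ColdingMinicozziEntropyValues
import Literature.MeasureTheory.Hausdorff.SphereAreaGeneral
import HarnessLib

/-!
# The entropy of the self-shrinking sphere: `λ(S^k_{√(2k)}) = F_{0,1}(S^k_{√(2k)}) = Λ_k`

For the round sphere `S = {‖x‖ = √(2k)}` of a `(k+1)`-dimensional real inner product space `V`
(`k ≥ 1`), with the Colding–Minicozzi Gaussian area `gaussianArea` and entropy `gaussianEntropy`
of `ColdingMinicozziEntropy.lean` (taken with respect to the Euclidean Hausdorff measure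
`μHE[k]`):

* `spherePathGaussian_one_le_zero` — Colding–Minicozzi's monotonicity (2012, Lemma 7.10 and its
  Claim (7.13)): along the path `(s y, 1 + a s²)`, `s ∈ [0,1]`, `1 + a > 0`, the Gaussian area of
  `S` does not increase (`g(1) ≤ g(0)`, from `g' ≤ 0`, `ShrinkingSphereMonotonicity.lean`);
* `gaussianArea_shrinkingSphere_le` — hence `F_{p,t}(S) ≤ F_{0,1}(S)` for all `p ∈ V`, `t > 0`,
  and `gaussianEntropy_shrinkingSphere_eq_gaussianArea`: **the entropy of the self-shrinking
  sphere is achieved at `(0,1)`**, `λ(S) = F_{0,1}(S)` (Colding–Minicozzi 2012, Lemma 7.10;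
  Colding–Ilmanen–Minicozzi–White 2013: "the entropy of a self-shrinker is equal to the value of
  `F` and, thus, no supremum is needed");
* `gaussianArea_zero_one_shrinkingSphere` — Stone's computation
  `F_{0,1}(S^k_{√(2k)}) = (4π)^{-k/2} e^{-k/2} (2k)^{k/2} |S^k| = |S^k| (k/(2πe))^{k/2} = Λ_k`
  (`sphereEntropy k`), using `μHE[k] (S^k_r) = r^k |S^k|` (`SphereAreaGeneral.lean`);
* `gaussianEntropy_shrinkingSphere` — **`λ(S^k_{√(2k)}) = Λ_k`** in any `(k+1)`-dimensional real
  inner product space.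

## References

* T. H. Colding, W. P. Minicozzi II, *Generic mean curvature flow I; generic singularities*,
  Ann. of Math. 175 (2012) 755–833, §7.2, Lemma 7.10, (7.13). [ColdingMinicozzi2012]
* T. H. Colding, T. Ilmanen, W. P. Minicozzi II, B. White, *The round sphere minimizes entropy
  among closed self-shrinkers*, J. Differential Geom. 95 (2013) 53–69, Introduction.
  [ColdingIlmanenMinicozziWhite2013]
* A. Stone, *A density function and the structure of singularities of the mean curvature flow*,
  Calc. Var. PDE 2 (1994) 443–480, Appendix A. [Stone1994]
-/

noncomputable section

open Set Metric Module Filter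
open _root_.MeasureTheory _root_.MeasureTheory.Measure
open scoped ENNReal NNReal Topology RealInnerProductSpace

namespace Literature.Geometry.Riemannian

variable {V : Type*} [NormedAddCommGroup V] [InnerProductSpace ℝ V] [FiniteDimensional ℝ V]
  [MeasurableSpace V] [BorelSpace V]

/-! ### Monotonicity along the paths -/

/-- **Colding–Minicozzi's Claim (7.13) for the self-shrinking sphere**: for `r² = 2k`, `r ≠ 0`,
`y ∈ V` and `1 + a > 0`, the path functional `g(s) = F_{s y, 1 + a s²}(S_r)` satisfies
`g(1) ≤ g(0)`, i.e.
`(4π(1+a))^{-k/2} ∫_{S_r} e^{-(r² - 2⟪y,x⟫ + ‖y‖²)/(4(1+a))} ≤ (4π)^{-k/2} ∫_{S_r} e^{-r²/4}`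
(`g' ≤ 0` on `[0,1]`, where `1 + a s² > 0`). [cite: ColdingMinicozzi2012, Lemma 7.10] -/
theorem spherePathGaussian_one_le_zero {k : ℕ} (hV : finrank ℝ V = k + 1) (y : V) {a r : ℝ}
    (hr : r ≠ 0) (hrk : r ^ 2 = 2 * k) (ha : 0 < 1 + a) :
    (4 * Real.pi * (1 + a)) ^ (-(k : ℝ) / 2) *
        ∫ x in sphere (0 : V) r, Real.exp (-(r ^ 2 - 2 * ⟪y, x⟫ + ‖y‖ ^ 2) / (4 * (1 + a)))
          ∂(μHE[k] : Measure V) ≤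
      (4 * Real.pi) ^ (-(k : ℝ) / 2) *
        ∫ _ in sphere (0 : V) r, Real.exp (-r ^ 2 / 4) ∂(μHE[k] : Measure V) := by
  set g : ℝ → ℝ := fun s ↦ (4 * Real.pi * (1 + a * s ^ 2)) ^ (-(k : ℝ) / 2) *
      ∫ x in sphere (0 : V) r,
        Real.exp (-(r ^ 2 - 2 * s * ⟪y, x⟫ + s ^ 2 * ‖y‖ ^ 2) / (4 * (1 + a * s ^ 2)))
          ∂(μHE[k] : Measure V) with hg_def
  -- `1 + a s² > 0` on `[0, 1]`
  have hT : ∀ s ∈ Icc (0 : ℝ) 1, 0 < 1 + a * s ^ 2 := by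
    intro s hs
    rcases le_or_gt 0 a with ha0 | ha0
    · have : 0 ≤ a * s ^ 2 := mul_nonneg ha0 (sq_nonneg s)
      linarith
    · have hs2 : s ^ 2 ≤ 1 := by
        have h1 : s ^ 2 ≤ 1 ^ 2 := pow_le_pow_left₀ hs.1 hs.2 2
        rwa [one_pow] at h1
      nlinarith
  have hderiv : ∀ s ∈ Icc (0 : ℝ) 1, HasDerivAt g
      ((4 * Real.pi * (1 + a * s ^ 2)) ^ (-(k : ℝ) / 2) *
        (-(s / (2 * (1 + a * s ^ 2) ^ 2)) * ∫ x in sphere (0 : V) r,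
          Real.exp (-(r ^ 2 - 2 * s * ⟪y, x⟫ + s ^ 2 * ‖y‖ ^ 2) / (4 * (1 + a * s ^ 2))) *
            (a * s * r + ⟪y, x⟫ / r) ^ 2 ∂(μHE[k] : Measure V))) s :=
    fun s hs ↦ hasDerivAt_spherePathGaussian hV y hr hrk (hT s hs)
  have hanti : AntitoneOn g (Icc 0 1) := by
    refine antitoneOn_of_deriv_nonpos (convex_Icc 0 1)
      (fun s hs ↦ (hderiv s hs).continuousAt.continuousWithinAt) ?_ ?_
    · rw [interior_Icc]
      exact fun s hs ↦ (hderiv s (Ioo_subset_Icc_self hs)).differentiableAt.differentiableWithinAt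
    · rw [interior_Icc]
      intro s hs
      rw [(hderiv s (Ioo_subset_Icc_self hs)).deriv]
      exact spherePathGaussian_deriv_nonpos y hs.1.le (hT s (Ioo_subset_Icc_self hs))
  have h10 := hanti (left_mem_Icc.2 zero_le_one) (right_mem_Icc.2 zero_le_one) zero_le_one
  simp only [hg_def, one_pow, mul_one, one_mul, zero_pow two_ne_zero, mul_zero, zero_mul, sub_zero,
    add_zero] at h10
  exact h10

/-! ### The Gaussian area of a round sphere in path form -/

/-- On the sphere `‖x‖ = r` the Gaussian weight is a function of `⟪p, x⟫`:
`e^{-‖x - p‖²/(4t)} = e^{-(r² - 2⟪p,x⟫ + ‖p‖²)/(4t)}`, so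
`F_{p,t}(S_r) = (4πt)^{-k/2} ∫_{S_r} e^{-(r² - 2⟪p,x⟫ + ‖p‖²)/(4t)} dμHE[k]` as a real number
(`dim V = k + 1`, `t > 0`). [cite: ColdingMinicozzi2012, (0.5)] -/
theorem gaussianArea_sphere_eq_ofReal {k : ℕ} (hV : finrank ℝ V = k + 1) (p : V) {t : ℝ}
    (ht : 0 < t) (r : ℝ) :
    gaussianArea k p t (sphere (0 : V) r) =
      ENNReal.ofReal ((4 * Real.pi * t) ^ (-(k : ℝ) / 2) *
        ∫ x in sphere (0 : V) r, Real.exp (-(r ^ 2 - 2 * ⟪p, x⟫ + ‖p‖ ^ 2) / (4 * t))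
          ∂(μHE[k] : Measure V)) := by
  have hcont : Continuous fun x : V ↦ Real.exp (-(r ^ 2 - 2 * ⟪p, x⟫ + ‖p‖ ^ 2) / (4 * t)) := by
    fun_prop
  have hint := integrableOn_sphere_of_continuous hV r hcont
  rw [gaussianArea_eq, gaussianNormalization, ENNReal.ofReal_mul (Real.rpow_nonneg (by positivity) _),
    ofReal_integral_eq_lintegral_ofReal hint (ae_of_all _ fun x ↦ (Real.exp_pos _).le)]
  congr 1
  refine setLIntegral_congr_fun isClosed_sphere.measurableSet fun x hx ↦ ?_
  simp only [gaussianWeight]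
  congr 2
  rw [norm_sub_sq_real, mem_sphere_zero_iff_norm.1 hx, real_inner_comm]

/-! ### The entropy of the self-shrinking sphere is achieved at `(0, 1)` -/

/-- **`F_{p,t}(S) ≤ F_{0,1}(S)` for the self-shrinking sphere** `S = {‖x‖ = √(2k)}` of a
`(k+1)`-dimensional real inner product space, every centre `p` and scale `t > 0`
(Colding–Minicozzi 2012, Lemma 7.10: for a self-shrinker "the function
`(x₀,t₀) → F_{x₀,t₀}(Σ)` has a strict (global) maximum at `x₀ = 0, t₀ = 1`"; here the non-strict
inequality, along the path `(s p, 1 + (t-1)s²)`). [cite: ColdingMinicozzi2012, Lemma 7.10] -/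
theorem gaussianArea_shrinkingSphere_le {k : ℕ} (hV : finrank ℝ V = k + 1) (hk : 0 < k) (p : V)
    {t : ℝ} (ht : 0 < t) :
    gaussianArea k p t (sphere (0 : V) (Real.sqrt (2 * k))) ≤
      gaussianArea k 0 1 (sphere (0 : V) (Real.sqrt (2 * k))) := by
  set r : ℝ := Real.sqrt (2 * k) with hr_def
  have hr : 0 < r := Real.sqrt_pos.2 (by positivity)
  have hrk : r ^ 2 = 2 * k := Real.sq_sqrt (by positivity)
  have ha : 0 < 1 + (t - 1) := by linarith
  have h := spherePathGaussian_one_le_zero hV p hr.ne' hrk ha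
  rw [gaussianArea_sphere_eq_ofReal hV p ht r, gaussianArea_sphere_eq_ofReal hV 0 one_pos r]
  refine ENNReal.ofReal_le_ofReal ?_
  have ht1 : (1 : ℝ) + (t - 1) = t := by ring
  rw [ht1] at h
  simp only [inner_zero_left, norm_zero, mul_zero, sub_zero, ne_eq, OfNat.ofNat_ne_zero,
    not_false_eq_true, zero_pow, add_zero, mul_one]
  convert h using 5

/-- **The entropy of the self-shrinking sphere is achieved by `F_{0,1}`**:
`λ(S^k_{√(2k)}) = F_{0,1}(S^k_{√(2k)})` in any `(k+1)`-dimensional real inner product space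
(`k ≥ 1`). Colding–Minicozzi 2012, Lemma 7.10; quoted in Colding–Ilmanen–Minicozzi–White 2013,
Introduction, and Bernstein–Wang 2016, §4 ("`λ_n = λ[Sⁿ] = F[Sⁿ]`").
[cite: ColdingMinicozzi2012, Lemma 7.10] -/
theorem gaussianEntropy_shrinkingSphere_eq_gaussianArea {k : ℕ} (hV : finrank ℝ V = k + 1)
    (hk : 0 < k) :
    gaussianEntropy k (sphere (0 : V) (Real.sqrt (2 * k))) =
      gaussianArea k 0 1 (sphere (0 : V) (Real.sqrt (2 * k))) := by
  refine le_antisymm ?_ (gaussianArea_le_gaussianEntropy k 0 one_pos _)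
  rw [gaussianEntropy_eq_iSup]
  exact iSup_le fun p ↦ iSup_le fun t ↦ iSup_le fun ht ↦ gaussianArea_shrinkingSphere_le hV hk p ht

/-! ### Stone's value -/

/-- **Stone's computation** (Stone 1994, Appendix A; Colding–Minicozzi 2012, Remark 1.7):
`F_{0,1}(S^k_{√(2k)}) = (4π)^{-k/2} e^{-k/2} (√(2k))^k |S^k| = |S^k| (k/(2πe))^{k/2} = Λ_k`,
with `|S^k| = μHE[k](S^k) = 2π^{(k+1)/2}/Γ((k+1)/2)` (`SphereAreaGeneral.lean`).
[cite: ColdingMinicozzi2012, Remark 1.7] -/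
theorem gaussianArea_zero_one_shrinkingSphere {k : ℕ} (hV : finrank ℝ V = k + 1) (hk : 0 < k) :
    gaussianArea k 0 1 (sphere (0 : V) (Real.sqrt (2 * k))) = ENNReal.ofReal (sphereEntropy k) := by
  set r : ℝ := Real.sqrt (2 * k) with hr_def
  have hk0 : (0 : ℝ) < k := by exact_mod_cast hk
  have hr : 0 < r := Real.sqrt_pos.2 (by positivity)
  have hrk : r ^ 2 = 2 * k := Real.sq_sqrt (by positivity)
  set A : ℝ := 2 * Real.pi ^ (((k : ℝ) + 1) / 2) / Real.Gamma (((k : ℝ) + 1) / 2) with hA_def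
  have hA : 0 < A := div_pos (mul_pos two_pos (Real.rpow_pos_of_pos Real.pi_pos _))
    (Real.Gamma_pos_of_pos (by positivity))
  -- the weight is constant on the sphere
  have hw : ∀ x ∈ sphere (0 : V) r, gaussianWeight (0 : V) 1 x = ENNReal.ofReal (Real.exp (-r ^ 2 / 4)) := by
    intro x hx
    simp only [gaussianWeight, sub_zero, mem_sphere_zero_iff_norm.1 hx, mul_one]
  rw [gaussianArea_eq, setLIntegral_congr_fun isClosed_sphere.measurableSet hw, setLIntegral_const,
    MeasureTheory.Hausdorff.euclideanHausdorffMeasure_sphere_general hV hk hr, ← hA_def,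
    gaussianNormalization, mul_one, ← ENNReal.ofReal_mul (Real.exp_pos _).le,
    ← ENNReal.ofReal_mul (Real.rpow_nonneg (by positivity) _)]
  congr 1
  -- the real identity `(4π)^{-k/2} e^{-r²/4} r^k A = A (k/(2πe))^{k/2}`
  rw [sphereEntropy, ← hA_def, hrk]
  have hq : (r : ℝ) ^ k = (2 * k) ^ ((k : ℝ) / 2) := by
    rw [hr_def, Real.sqrt_eq_rpow, ← Real.rpow_natCast, ← Real.rpow_mul (by positivity)]
    congr 1
    ring
  have hexp : Real.exp (-(2 * (k : ℝ)) / 4) = (Real.exp 1)⁻¹ ^ ((k : ℝ) / 2) := by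
    rw [← Real.exp_neg, ← Real.exp_mul]
    congr 1
    ring
  have h4pi : (4 * Real.pi) ^ (-(k : ℝ) / 2) = ((4 * Real.pi)⁻¹) ^ ((k : ℝ) / 2) := by
    rw [Real.inv_rpow (by positivity), ← Real.rpow_neg (by positivity)]
    congr 1
    ring
  rw [hq, hexp, h4pi]
  have hbase : (k : ℝ) / (2 * Real.pi * Real.exp 1) = (4 * Real.pi)⁻¹ * ((Real.exp 1)⁻¹ * (2 * k)) := by
    field_simp
    ring
  rw [hbase, Real.mul_rpow (x := (4 * Real.pi)⁻¹) (by positivity) (by positivity),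
    Real.mul_rpow (x := (Real.exp 1)⁻¹) (y := 2 * (k : ℝ)) (by positivity) (by positivity)]
  ring

/-- **The entropy of the self-shrinking `k`-sphere is Stone's constant**:
`λ(S^k_{√(2k)}) = Λ_k = |S^k| (k/(2πe))^{k/2}` (`= sphereEntropy k`) in any `(k+1)`-dimensional
real inner product space, `k ≥ 1` (Stone 1994, Appendix A, with Colding–Minicozzi 2012,
Lemma 7.10; Colding–Ilmanen–Minicozzi–White 2013, Introduction:
"`λ(S¹) = √(2π/e) ≈ 1.5203 > λ(S²) = 4/e ≈ 1.4715 > λ(S³) > ⋯`").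
[cite: ColdingIlmanenMinicozziWhite2013, Introduction] -/
theorem gaussianEntropy_shrinkingSphere {k : ℕ} (hV : finrank ℝ V = k + 1) (hk : 0 < k) :
    gaussianEntropy k (sphere (0 : V) (Real.sqrt (2 * k))) = ENNReal.ofReal (sphereEntropy k) := by
  rw [gaussianEntropy_shrinkingSphere_eq_gaussianArea hV hk, gaussianArea_zero_one_shrinkingSphere hV hk]

end Literature.Geometry.Riemannian

end
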